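import Summits.QuantumFields.YangMills.Theorems.BalabanUVNodesN15KingModelLandauFlux
import Summits.QuantumFields.YangMills.Theorems.BalabanUVNodesN15KingModelToronHolonomyGap
import HarnessLib

/-!
# BalabanUVNodes ∕ N15 — THE KING-MODEL RUNG (PART Ϡ-l): ONE FLUX QUANTUM — on King's torus the flux is quantised (`p′_{ν₀} ∈ (2π∕K_{ν₀})ℤ`), so EVERY non-zero constant flux through the
# `(ν₀,ν₁)`-plaquettes gives King's covariant fine operator a gap `≥ c·min(|p′|∕4, 1∕(2π²)) ≥ πc∕(2K_{ν₀})` (`K_{ν₀} ≥ 32`): a single flux quantum opens a gap of order `c∕K` (the Landau level of the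
# minimal flux `2π∕K`), whereas a flat holonomy (a toron, PART Ͷ-d) gives only `c·Σ(θ_μ∕K_μ)² = O(c∕K²)`
# (Track A, DAG node N15 = NE2; FAN-OUT v1.1 §N15 s3 «KING-MODEL RUNG … + what the curved case adds»; count-neutral)

HONEST FRAMING.  Count-neutral (cell `pub-ymgap`, seat `pub-ymgap-dag-n15-e` g47; `--supports stmt-QuantumFields-27247 --as helper` = K3ᴬ, KEY MAP v3).  Arithmetic on PART Ϡ-c (Landau floor,
`|p′| ≤ 1`) and PART Ϳ-c (plaquette floor `2(2−2cos(p′∕4)) ≥ p′²∕(2π²)`, any `p′`) plus the quantisation of King's torus momenta (`p′ = 2π·valMinAbs(p)∕K`, [Balaban1984PropagatorsI] (1.29)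
p.23; tree `B5Prop11Plancherel.sOf`).  King's fine covariance layer [King1986] (symbol (4.4) p.670) ∕ [Balaban1985BackgroundPropagators] (3.23) p.394 at the `U(1)` constant-flux field, Landau
gauge.  NOT Bałaban's `G_k(U)`; NOT a node discharge (N15 of record untouched); nothing continuum-YM ∕ ℝ⁴ ∕ OS ∕ Clay.

THE RESULTS (`U = fluxLink p ν₁`, `p_{ν₁} = 0`, `ν₀ ≠ ν₁`, `c ≥ 0`):
* `abs_sOf_ge_flux_quantum` (`p_{ν₀} ≠ 0 ⟹ 2π∕K_{ν₀} ≤ |p′_{ν₀}|`: FLUX QUANTISATION), ★ `bestGap_ge_min` (given Ϳ-a's `θ²∕(4π²) ≤ 2−2cos(θ∕4)`: `max(2(2−2cos(θ∕4)), Λ(θ)) ≥ min(|θ|∕4, 1∕(2π²))` — Landau for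
  `|θ| ≤ 1`, plaquette for `|θ| ≥ 1`), ★★ **`re_quadForm_covLapF_fluxLink_ge_uniform`** (`(m² + c·min(|p′|∕4, 1∕(2π²)))Σ‖v_x‖² ≤ Re⟨v,(−cΔ_U+m²)v⟩` at EVERY flux), ★★★
  **`eigenvalues_covLapF_fluxLink_ge_flux_quantum`** (`p_{ν₀} ≠ 0`, `K_{ν₀} ≥ 32`: every eigenvalue `≥ m² + πc∕(2K_{ν₀})`), ★★ **`posDef_covLapF_fluxLink_massless_all_flux`** (`c > 0`, `p_{ν₀} ≠ 0`, any
  `K`: the massless covariant Laplacian is positive definite at EVERY non-zero constant flux — Ϳ-c's `posDef_covLapF_fluxLink_massless` recovered with the Landau constant where it is better),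
  ★★ **`flux_quantum_vs_holonomy`** (the contrast in one conjunction: toron gap `≤ c·Σ_μ(θ_μ∕K_μ)²` (Ͷ-d `holonomyGap_le_sq`) ∧ one-flux-quantum gap `≥ πc∕(2K_{ν₀})`).
PRIOR TREE ART (by name): Ϡ-a (`landauGap`, `landauGap_ge_quarter`), Ϡ-c (`re_quadForm_covLapF_fluxLink_ge_best`, `eigenvalues_covLapF_ge_of_coercive`, `posDef_covLapF_of_coercive`), Ϳ-c (`fluxGap_ge_sq`), Ͷ-d
(`holonomyGap`, `holonomyGap_le_sq`), `B5Prop11Plancherel` (`sOf`), Mathlib (`Real.pi_gt_three`, `Real.pi_lt_d2`, `ZMod.valMinAbs_eq_zero`).  Dedup (rg at filing): basename 0 files;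
needles `flux_quantum|bestGap_ge_min|_ge_uniform|_all_flux` 0 tree files.  Locators: [King1986] symbol (4.4) p.670, (2.12) p.653; [Balaban1984PropagatorsI] (1.29)–(1.31) p.23;
[Balaban1985BackgroundPropagators] (3.23) p.394; [tHooft1979Flux] NPB 153 (flux quantisation on the torus, notion).  0 `sorry`, 0 `def`.
-/

noncomputable section
open scoped BigOperators ComplexConjugate ComplexOrder
open Finset Matrix WithLp

namespace Summit.QuantumFields.YangMills.BalabanUVNodes.N15KingModelRung.Landau

open Literature.MathematicalPhysics.QuantumFieldTheory.Balaban1983to89.B5Prop11Plancherel (Tor unitVec sOf)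
open Summit.QuantumFields.YangMills.BalabanUVNodes.N15KingModelRung.Covariant (covLapF fib isHermitian_covLapF)
open Summit.QuantumFields.YangMills.BalabanUVNodes.N15KingModelRung.Cover (fluxLink)
open Summit.QuantumFields.YangMills.BalabanUVNodes.N15KingModelRung.Curvature (fluxGap_ge_sq)
open Summit.QuantumFields.YangMills.BalabanUVNodes.N15KingModelRung.Toron (holonomyGap holonomyGap_le_sq)

variable {d : ℕ} (K : Fin (d + 1) → ℕ) [hK : ∀ μ, NeZero (K μ)] {c : ℝ}

/-- ★ **FLUX QUANTISATION**: `p_{ν₀} ≠ 0 ⟹ |p′_{ν₀}| ≥ 2π∕K_{ν₀}` (`p′ = 2π·valMinAbs(p_{ν₀})∕K_{ν₀}` with a NON-ZERO INTEGER numerator). [cite: Balaban1984PropagatorsI, (1.29) p.23; tHooft1979Flux, NPB 153 (flux quantisation, notion)] -/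
theorem abs_sOf_ge_flux_quantum {p : Tor K} {ν₀ : Fin (d + 1)} (hp0 : p ν₀ ≠ 0) : 2 * Real.pi / K ν₀ ≤ |sOf K p ν₀| := by
  have hK0 : (0 : ℝ) < K ν₀ := by exact_mod_cast Nat.pos_of_ne_zero (NeZero.ne _)
  have hv : (p ν₀).valMinAbs ≠ 0 := (ZMod.valMinAbs_eq_zero (p ν₀)).not.mpr hp0
  have hv1 : (1 : ℝ) ≤ |((p ν₀).valMinAbs : ℝ)| := by
    rw [← Int.cast_abs]; exact_mod_cast Int.one_le_abs hv
  unfold sOf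
  rw [abs_div, abs_of_pos hK0, abs_mul, abs_of_pos (by positivity : (0 : ℝ) < 2 * Real.pi)]
  exact div_le_div_of_nonneg_right (by nlinarith [Real.pi_pos]) hK0.le

omit hK in
/-- ★ **THE BEST OF THE TWO ROADS IS UNIFORMLY POSITIVE**: given the plaquette floor `θ²∕(4π²) ≤ 2−2cos(θ∕4)` (Ϳ-a, `|θ| ≤ π`), `max(2(2−2cos(θ∕4)), Λ(θ)) ≥ min(|θ|∕4, 1∕(2π²))` — the Landau
road for `|θ| ≤ 1`, the plaquette road for `|θ| ≥ 1`. [folklore] -/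
theorem bestGap_ge_min {θ : ℝ} (hsq : θ ^ 2 / (4 * Real.pi ^ 2) ≤ 2 - 2 * Real.cos (θ / 4)) :
    min (|θ| / 4) (1 / (2 * Real.pi ^ 2)) ≤ max (2 * (2 - 2 * Real.cos (θ / 4))) (landauGap θ) := by
  rcases le_or_gt |θ| 1 with h1 | h1
  · exact (min_le_left _ _).trans ((landauGap_ge_quarter h1).trans (le_max_right _ _))
  · have hπ : 0 < Real.pi := Real.pi_pos
    have h2 : 1 / (2 * Real.pi ^ 2) ≤ 2 * (2 - 2 * Real.cos (θ / 4)) := by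
      have hθ2 : 1 ≤ θ ^ 2 := by rw [← sq_abs]; nlinarith
      calc 1 / (2 * Real.pi ^ 2) ≤ θ ^ 2 / (2 * Real.pi ^ 2) := div_le_div_of_nonneg_right hθ2 (by positivity)
        _ = 2 * (θ ^ 2 / (4 * Real.pi ^ 2)) := by ring
        _ ≤ 2 * (2 - 2 * Real.cos (θ / 4)) := by linarith
    exact (min_le_right _ _).trans (h2.trans (le_max_left _ _))

/-- ★★ **A FLUX-UNIFORM FLOOR**: `(m² + c·min(|p′_{ν₀}|∕4, 1∕(2π²)))·Σ‖v_x‖² ≤ Re⟨v,(−cΔ_U+m²)v⟩` at EVERY constant flux (`p_{ν₁} = 0`, `ν₀ ≠ ν₁`, `c ≥ 0`).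
[cite: King1986, (4.4) p.670, (2.12) p.653; Balaban1985BackgroundPropagators, (3.23) p.394] -/
theorem re_quadForm_covLapF_fluxLink_ge_uniform (hc : 0 ≤ c) (m2 : ℝ) {p : Tor K} {ν₀ ν₁ : Fin (d + 1)} (hν : ν₀ ≠ ν₁) (hp : p ν₁ = 0) (v : Tor K × Unit → ℂ) :
    (m2 + c * min (|sOf K p ν₀| / 4) (1 / (2 * Real.pi ^ 2))) * ∑ x, ‖fib K v x‖ ^ 2 ≤ (star v ⬝ᵥ (covLapF K c m2 (fluxLink K p ν₁) *ᵥ v)).re := by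
  have h := re_quadForm_covLapF_fluxLink_ge_best K hc m2 hν hp v
  have hmin := bestGap_ge_min (fluxGap_ge_sq K p ν₀)
  have hS : 0 ≤ ∑ x, ‖fib K v x‖ ^ 2 := Finset.sum_nonneg fun _ _ => sq_nonneg _
  exact le_trans (mul_le_mul_of_nonneg_right (by nlinarith [mul_le_mul_of_nonneg_left hmin hc]) hS) h

omit hK in
/-- `π³ < 32` (so that `π∕(2K) ≤ 1∕(2π²)` once `K ≥ 32`). [folklore] -/
theorem pi_cube_lt : Real.pi ^ 3 < 32 := by
  have h := Real.pi_lt_d2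
  have h0 := Real.pi_pos
  nlinarith [mul_pos h0 h0]

/-- ★★★ **ONE FLUX QUANTUM OPENS A GAP OF ORDER `c∕K`**: `p_{ν₀} ≠ 0`, `p_{ν₁} = 0`, `ν₀ ≠ ν₁`, `K_{ν₀} ≥ 32`, `c ≥ 0` ⟹ every eigenvalue of `−cΔ_U+m²` at the flux field is `≥ m² + πc∕(2K_{ν₀})`
(`min(|p′|∕4, 1∕(2π²)) ≥ min(π∕(2K), 1∕(2π²)) = π∕(2K)`). [cite: King1986, (4.4) p.670; Balaban1984PropagatorsI, (1.29) p.23; tHooft1979Flux, NPB 153 (notion)] -/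
theorem eigenvalues_covLapF_fluxLink_ge_flux_quantum (hc : 0 ≤ c) (m2 : ℝ) {p : Tor K} {ν₀ ν₁ : Fin (d + 1)} (hν : ν₀ ≠ ν₁) (hp : p ν₁ = 0) (hp0 : p ν₀ ≠ 0) (hK32 : 32 ≤ K ν₀)
    (i : Tor K × Unit) : m2 + Real.pi * c / (2 * K ν₀) ≤ (isHermitian_covLapF K c m2 (fluxLink K p ν₁)).eigenvalues i := by
  have hK0 : (0 : ℝ) < K ν₀ := by exact_mod_cast Nat.pos_of_ne_zero (NeZero.ne _)
  have hK32' : (32 : ℝ) ≤ K ν₀ := by exact_mod_cast hK32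
  have hq := abs_sOf_ge_flux_quantum K hp0 (ν₀ := ν₀)
  have hπ := Real.pi_pos
  -- `π∕(2K) ≤ min(|p′|∕4, 1∕(2π²))`
  have hmin : Real.pi / (2 * K ν₀) ≤ min (|sOf K p ν₀| / 4) (1 / (2 * Real.pi ^ 2)) := by
    refine le_min ?_ ?_
    · calc Real.pi / (2 * K ν₀) = (2 * Real.pi / K ν₀) / 4 := by field_simp; ring
        _ ≤ |sOf K p ν₀| / 4 := by linarith
    · rw [div_le_div_iff₀ (by positivity) (by positivity)]
      nlinarith [pi_cube_lt, mul_pos hπ hπ]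
  have h := eigenvalues_covLapF_ge_of_coercive K c m2 _ (fun v => re_quadForm_covLapF_fluxLink_ge_uniform K hc m2 hν hp v) i
  have : m2 + Real.pi * c / (2 * K ν₀) ≤ m2 + c * min (|sOf K p ν₀| / 4) (1 / (2 * Real.pi ^ 2)) := by
    have := mul_le_mul_of_nonneg_left hmin hc
    calc m2 + Real.pi * c / (2 * K ν₀) = m2 + c * (Real.pi / (2 * K ν₀)) := by ring
      _ ≤ _ := by linarith
  exact this.trans h

/-- ★★ **THE MASSLESS COVARIANT LAPLACIAN IS POSITIVE DEFINITE AT EVERY NON-ZERO CONSTANT FLUX** (`c > 0`, `p_{ν₀} ≠ 0`, `p_{ν₁} = 0`, `ν₀ ≠ ν₁`, ANY `K`), with the flux-uniform floor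
`c·min(|p′|∕4, 1∕(2π²))`. [cite: DodziukMathai2006, Cor 1.3 §1; King1986, (4.4) p.670] -/
theorem posDef_covLapF_fluxLink_massless_all_flux (hc : 0 < c) {p : Tor K} {ν₀ ν₁ : Fin (d + 1)} (hν : ν₀ ≠ ν₁) (hp : p ν₁ = 0) (hp0 : p ν₀ ≠ 0) :
    (covLapF K c 0 (fluxLink K p ν₁)).PosDef := by
  have hq := abs_sOf_ge_flux_quantum K hp0 (ν₀ := ν₀)
  have hK0 : (0 : ℝ) < K ν₀ := by exact_mod_cast Nat.pos_of_ne_zero (NeZero.ne _)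
  have hq' : 0 < 2 * Real.pi / K ν₀ := by positivity
  have hpos : 0 < min (|sOf K p ν₀| / 4) (1 / (2 * Real.pi ^ 2)) := lt_min (by linarith) (by positivity)
  exact posDef_covLapF_of_coercive K c 0 _ (by rw [zero_add]; exact mul_pos hc hpos) fun v => re_quadForm_covLapF_fluxLink_ge_uniform K hc.le 0 hν hp v

/-- ★★ **FLUX QUANTUM VERSUS HOLONOMY, IN ONE CONJUNCTION** (`c ≥ 0`): a TORON (flat; holonomy phases `θ_μ`) has gap `≤ c·Σ_μ(θ_μ∕K_μ)² = O(c∕K²)` (PART Ͷ-d), while ONE FLUX QUANTUM through the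
`(ν₀,ν₁)`-plaquettes gives every eigenvalue `≥ m² + πc∕(2K_{ν₀}) = m² + O(c∕K)` (`K_{ν₀} ≥ 32`) — curvature beats holonomy by a factor of the linear size.
[cite: King1986, (4.4) p.670, (2.12) p.653; tHooft1979Flux, NPB 153 (notion)] -/
theorem flux_quantum_vs_holonomy (hc : 0 ≤ c) (m2 : ℝ) {p : Tor K} {ν₀ ν₁ : Fin (d + 1)} (hν : ν₀ ≠ ν₁) (hp : p ν₁ = 0) (hp0 : p ν₀ ≠ 0) (hK32 : 32 ≤ K ν₀) :
    (∀ θ : Fin (d + 1) → ℝ, holonomyGap K c θ ≤ c * ∑ μ, (θ μ / K μ) ^ 2)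
      ∧ ∀ i, m2 + Real.pi * c / (2 * K ν₀) ≤ (isHermitian_covLapF K c m2 (fluxLink K p ν₁)).eigenvalues i :=
  ⟨fun θ => holonomyGap_le_sq K hc θ, eigenvalues_covLapF_fluxLink_ge_flux_quantum K hc m2 hν hp hp0 hK32⟩

end Summit.QuantumFields.YangMills.BalabanUVNodes.N15KingModelRung.Landau

end
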